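import Summits.BirchSwinnertonDyer.BirchSwinnertonDyer.Theorems.ClassRecordThreeEulerHalvesAtThreeJetchevNotRam

/-!
# Route `ClassRecordThree` (rung K2@3), crux 5 `EulerHalvesAtThree` (item 19109, shared by
# `KolyvaginRoadThree`): the composition with the Jetchev binders NARROWED to the frames it uses
# (J₃ʳ♭ ∕ J₃⁰♭: `r_an = 1`, `d_K` odd, `L(E^{d_K},1) ≠ 0`) — RESHAPE of the registered skeleton
# (cell `bsd-stepL`, seat `bsd-stepL-tam3-p1`, session g2; `--supports stmt-BirchSwinnertonDyer-19109 --as helper`)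

Files 1–2 of this seat (p419384 ∕ p419735) compose the crux from J₃ʳ ∕ J₃⁰ ∕ TL₃, where J₃ʳ ∕ J₃⁰ ask global
`3^s`-divisibility of the derived Heegner points at EVERY Manin-good conductor-`1` frame over EVERY imaginary
quadratic Heegner `K` with `d_K ≠ −3` — also over `K` with even `d_K` or with `r_an(E/K) ≥ 3` (where `y_K` is
torsion and McCallum's `M₀` is undefined), which the proofs never visit: they apply the binder at ONE
Hoffstein–Luo field (`exists_oddHeegnerData`: `d_K` odd, `L(E^{d_K},1) ≠ 0`). This file re-runs the two proofs
and the crux composition with the binders narrowed accordingly: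

§1 X11b@3 ∧ (ram) from J₃ʳ♭ (file 1 §2 verbatim otherwise); §2 ¬(ram) ∧ surj from J₃⁰♭ + TL₃ (file 2 §3);
§3 the crux BY NAME (+ the `KolyvaginRoadThree` twin) from the published facts and exactly {J₃ʳ♭, J₃⁰♭, TL₃};
§4 the registered broad stubs imply the narrowed ones (`3 ∣ N` + Heegner give `3 ∤ d_K`, so `d_K ≠ −3`).
With the companion `ClassRecordThreeEulerHalvesAtThreeJetchevNecessary.lean` (J₃ʳ♭ ⟸ the Euler-system half on
X11b@3 ∧ (ram); J₃⁰♭ ⟸ clause (0); modulo print) the narrowed binders are EQUIVALENT to the crux content they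
serve. HONEST FRAMING: hypothesis-shaped binders; nothing asserted; no item closes. References: as in files 1–2.
-/

noncomputable section

open scoped Classical

namespace Summit.BirchSwinnertonDyer.Rank1Residual.X11b.Three.Koly

open WeierstrassCurve Literature.NumberTheory.EllipticCurves
  Literature.NumberTheory.EllipticCurves.ModularForms
  Literature.NumberTheory.EllipticCurves.Rank1Residual
  Summit.BirchSwinnertonDyer.Rank1Residual Summit.BirchSwinnertonDyer.Rank1Residual.X11b

/-! ### §1 X11b@3 ∧ (ram) from J₃ʳ♭ -/

/-- **The Euler-system half on X11b@3 ∧ (ram) from J₃ʳ♭ (the NARROWED Jetchev binder).** Same statement,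
inputs and proof as file 1's `missingUpperBoundAt_three_of_classX11b_of_ram_of_jetchevDivisibility`, with the open
input asked ONLY where that proof uses it: on Manin-good conductor-`1` frames over imaginary quadratic Heegner `K`
with `d_K` ODD and `L(E^{d_K},1) ≠ 0`, of curves with `r_an = 1` (binder `hJ` = J₃ʳ♭; the broad J₃ʳ implies it,
`jetchevDivisibilityRamHL_of_jetchevDivisibilityRam`). CONDITIONAL on every binder; nothing booked.
[cite: McCallumLMS1991, §5 Cor. 5.6 (p. 310)] [cite: Jetchev2008, Conj. 1.3 (p. 812)]
[cite: JetchevSkinnerWan2017, §7.4.2 (p. 31)] [cite: Skinner2016PacificMC, Thm. C (§1) and footnote 1]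
[cite: Darmon2004, Thm. 3.6 (PDF p. 43)] [cite: HoffsteinLuo1997, Theorem (§1)] -/
theorem missingUpperBoundAt_three_of_classX11b_of_ram_of_jetchevDivisibilityHL
    -- published named facts
    (hGZ : ∀ (N : ℕ) [NeZero N] (W : WeierstrassCurve ℚ) (K : Type) [Field K] [NumberField K],
      gross_zagier N W K)
    (hKo : ∀ (N : ℕ) [NeZero N] (W : WeierstrassCurve ℚ) (K : Type) [Field K] [NumberField K],
      kolyvagin N W K)
    (hSk : Skinner2016.thmC_padicValRat_bsd_rank_zero)
    (hGZK : rank_eq_analyticRank_of_analyticRank_le_one) (hmod : hasEntireLFunction_rat)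
    (hnf : exists_isNewformOf) (hHL : HoffsteinLuo1997_exists_twist_L_one_ne_zero)
    (hMaz : mazur_not_dvd_maninConstant_of_odd)
    (hrec : ∀ (N : ℕ) [NeZero N] (W : WeierstrassCurve ℚ) (K : Type) [Field K] [NumberField K],
      heegnerPointOfConductor_one_galoisConj N W K)
    (hD36 : ∀ (N : ℕ) [NeZero N] (W : WeierstrassCurve ℚ) (K : Type) [Field K] [NumberField K],
      phi_heegnerTau_mem_singularModuliField N W K)
    (hMcU : McCallum1991_padicValNat_card_sha_primary_add_le_of_globalDivisibility)
    -- OPEN INPUT J₃ʳ: the Jetchev direction at 3 ∥ N on (ram) ∧ surj frames (hypothesis shape)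
    (hJ : ∀ (W : WeierstrassCurve ℚ) [W.IsElliptic] [W.IsGloballyMinimal] [NeZero (W.conductorNorm ℤ)]
      (K : Type) [Field K] [NumberField K]
      (Dt : ModularParametrizationData W (W.conductorNorm ℤ)) (β : ℤ) (ι : K →+* ℂ),
      W.analyticRank = 1 → W.HasMultiplicativeReductionAtPrime 3 → Surj W 3 → Ram W 3 →
      IsImaginaryQuadratic K → SatisfiesHeegnerHypothesis (W.conductorNorm ℤ) K →
      Odd (NumberField.discr K) → (W.quadraticTwist (NumberField.discr K : ℚ)).entireLFunction 1 ≠ 0 →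
      (4 * (W.conductorNorm ℤ : ℤ)) ∣ β ^ 2 - NumberField.discr K → ¬ (3 : ℤ) ∣ Dt.c →
      ∀ (s : ℕ), s ≤ padicValNat 3 W.tamagawaProduct →
        ∀ (n : ℕ) (d : KolyvaginHeegnerData Dt β ι n), Squarefree n →
          (∀ ℓ ∈ n.primeFactors, Zhang2014.IsKolyvaginPrime (W.conductorNorm ℤ) W K 3 ℓ ∧
            s ≤ Zhang2014.kolyvaginIndex W 3 ℓ) → PDiv d 3 s)
    -- the pair
    (W : WeierstrassCurve ℚ) [W.IsElliptic] [W.IsGloballyMinimal]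
    (hX : ClassX11b W 3) (hram : Ram W 3) : Typed.MissingUpperBoundAt W 3 := by
  haveI : NeZero (W.conductorNorm ℤ) := ⟨(W.conductorNorm_pos_holds).ne'⟩
  obtain ⟨hr, h32, hmult, hirr⟩ := hX
  have hρ : Surj W 3 := surj_of_irr_of_ram W 3 hirr hram
  -- ONE odd Heegner datum with a Manin-good frame (Hoffstein–Luo field; Mazur; w_K = 2)
  obtain ⟨K, _, _, Dt, H, ι, P, Wd, _, _, Cd, hK, hodd, h3d, hHN, hP, hc, hμ, hLt, hWd⟩ :=
    exists_oddHeegnerData hnf hHL hMaz integral_neronScaling_of_isGloballyMinimal_holds W 3 hr h32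
      hmult hirr
  have h3 : NumberField.discr K ≠ -3 := by
    intro h
    exact h3d (h ▸ ⟨-1, by norm_num⟩)
  have h4 : NumberField.discr K ≠ -4 := by
    intro h
    rw [h] at hodd
    exact (Int.not_odd_iff_even.mpr ⟨-2, by norm_num⟩) hodd
  -- a conductor-1 Kolyvagin–Heegner datum on the frame (Dt, H.β, ι) (Darmon 2004, Thm. 3.6)
  obtain ⟨d₁⟩ := exists_kolyvaginHeegnerData_one (hD36 _ W K) hK Dt H.β ι H.dvd_sq_sub
  -- the bottom point: P(1) = y_K = P in E(K̄) (Shimura reciprocity at conductor 1)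
  have hPd : d₁.toGeomPoints d₁.derivedPoint = toGeomPoints (W.baseChange K) P :=
    KolyvaginBottom.toGeomPoints_derivedPoint_one_eq (hrec _ W K) hK hHN hP d₁ rfl
  -- the sharpened bound over K at this datum, from J₃ʳ + McCallum (§1)
  have hU : Finite (W.baseChange K).sha → ¬ IsOfFinAddOrder P →
      padicValNat 3 (Nat.card (W.baseChange K).sha) + 2 * padicValNat 3 W.tamagawaProduct ≤
        2 * padicValNat 3 (AddSubgroup.zmultiples P).index := by
    intro hfin hPinf
    haveI : Finite (W.baseChange K).sha := hfin
    -- rank one (Kolyvagin) and no 3-torsion (E[3] irreducible, K imaginary quadratic)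
    obtain ⟨hrank, -⟩ := hKo (W.conductorNorm ℤ) W K hK hHN ⟨Dt, H, ι, hP⟩ hPinf
    have hbot := torsionBy_eq_bot_of_isImaginaryQuadratic_of_hasIrreducibleModPGaloisRep W K hK
      Nat.prime_three hirr
    have hiv : ∀ x : (W.baseChange K).toAffine.Point, 3 • x = 0 → x = 0 := fun x hx ↦ by
      have hmem : x ∈ AddSubgroup.torsionBy (W.baseChange K).toAffine.Point ((3 : ℕ) : ℤ) := by
        rw [mem_torsionBy_iff, natCast_zsmul]
        exact hx
      rw [hbot] at hmem
      exact hmem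
    exact shaIndexBound_sharp_three_of_globalDivisibility hMcU W K hmult hρ hK h3 h4 hHN Dt H.β ι d₁ P
      hPd hPinf hrank hiv (hJ W K Dt H.β ι hr hmult hρ hram hK hHN hodd hLt H.dvd_sq_sub hc)
  -- descent to ℚ: GZ bookkeeping, twist transports, Skinner Thm. C for E^{d_K} (x11b3)
  exact missingUpperBoundAt_of_sharpIndexBound_of_le W 3 K Dt H ι P (hGZ _ W K) (hKo _ W K) hSk hGZK
    hmod hr h32 hmult hirr hram hK hodd h3d hHN hP hc hμ hLt Wd Cd hWd (padicValNat 3 W.tamagawaProduct)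
    le_rfl hU

/-! ### §2 ¬(ram) ∧ surj from J₃⁰♭ + TL₃ -/

/-- **The Euler-system half on ¬(ram) ∧ surj from J₃⁰♭ (narrowed) + TL₃.** Same statement, inputs and proof
as file 2's `missingUpperBoundAt_three_of_classX11b_of_surj_of_not_ram_of_jetchevDivisibility_of_twistLower`, with
the Jetchev binder narrowed to the Hoffstein–Luo-type frames the proof uses (`hJ0` = J₃⁰♭). CONDITIONAL.
[cite: McCallumLMS1991, §5 Cor. 5.6 (p. 310)] [cite: Skinner2016PacificMC, Thm. C (§1) — shape of TL₃ only]
[cite: JetchevSkinnerWan2017, §7.4.2 (p. 31)] [cite: Darmon2004, Thm. 3.6 (PDF p. 43)] -/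
theorem missingUpperBoundAt_three_of_classX11b_of_surj_of_not_ram_of_jetchevDivisibilityHL_of_twistLower
    -- published named facts
    (hGZ : ∀ (N : ℕ) [NeZero N] (W : WeierstrassCurve ℚ) (K : Type) [Field K] [NumberField K],
      gross_zagier N W K)
    (hKo : ∀ (N : ℕ) [NeZero N] (W : WeierstrassCurve ℚ) (K : Type) [Field K] [NumberField K],
      kolyvagin N W K)
    (hGZK : rank_eq_analyticRank_of_analyticRank_le_one) (hmod : hasEntireLFunction_rat)
    (hnf : exists_isNewformOf) (hHL : HoffsteinLuo1997_exists_twist_L_one_ne_zero)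
    (hMaz : mazur_not_dvd_maninConstant_of_odd)
    (hrec : ∀ (N : ℕ) [NeZero N] (W : WeierstrassCurve ℚ) (K : Type) [Field K] [NumberField K],
      heegnerPointOfConductor_one_galoisConj N W K)
    (hD36 : ∀ (N : ℕ) [NeZero N] (W : WeierstrassCurve ℚ) (K : Type) [Field K] [NumberField K],
      phi_heegnerTau_mem_singularModuliField N W K)
    (hMcU : McCallum1991_padicValNat_card_sha_primary_add_le_of_globalDivisibility)
    -- OPEN INPUT J₃⁰: the Jetchev direction at 3 ∥ N on ¬(ram) ∧ surj frames (hypothesis shape)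
    (hJ0 : ∀ (W : WeierstrassCurve ℚ) [W.IsElliptic] [W.IsGloballyMinimal] [NeZero (W.conductorNorm ℤ)]
      (K : Type) [Field K] [NumberField K]
      (Dt : ModularParametrizationData W (W.conductorNorm ℤ)) (β : ℤ) (ι : K →+* ℂ),
      W.analyticRank = 1 → W.HasMultiplicativeReductionAtPrime 3 → Surj W 3 → ¬ Ram W 3 →
      IsImaginaryQuadratic K → SatisfiesHeegnerHypothesis (W.conductorNorm ℤ) K →
      Odd (NumberField.discr K) → (W.quadraticTwist (NumberField.discr K : ℚ)).entireLFunction 1 ≠ 0 →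
      (4 * (W.conductorNorm ℤ : ℤ)) ∣ β ^ 2 - NumberField.discr K → ¬ (3 : ℤ) ∣ Dt.c →
      ∀ (s : ℕ), s ≤ padicValNat 3 W.tamagawaProduct →
        ∀ (n : ℕ) (d : KolyvaginHeegnerData Dt β ι n), Squarefree n →
          (∀ ℓ ∈ n.primeFactors, Zhang2014.IsKolyvaginPrime (W.conductorNorm ℤ) W K 3 ℓ ∧
            s ≤ Zhang2014.kolyvaginIndex W 3 ℓ) → PDiv d 3 s)
    -- OPEN INPUT TL₃: the rank-0 3-part lower bound at a multiplicative 3, E[3] irreducible, NO (ram)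
    (hTL : ∀ (V : WeierstrassCurve ℚ) [V.IsElliptic] [V.IsGloballyMinimal],
      V.HasMultiplicativeReductionAtPrime 3 → V.HasIrreducibleModPGaloisRep 3 →
      V.entireLFunction 1 ≠ 0 → Finite V.sha →
      ∃ q : ℚ, V.entireLFunction 1 / (V.realPeriodRat : ℂ) = (q : ℂ) ∧
        padicValRat 3 q ≤ (padicValNat 3 V.shaOrder : ℤ) + padicValNat 3 V.tamagawaProduct -
          2 * padicValNat 3 V.torsionOrder)
    -- the pair
    (W : WeierstrassCurve ℚ) [W.IsElliptic] [W.IsGloballyMinimal]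
    (hX : ClassX11b W 3) (hρ : Surj W 3) (hnram : ¬ Ram W 3) : Typed.MissingUpperBoundAt W 3 := by
  haveI : NeZero (W.conductorNorm ℤ) := ⟨(W.conductorNorm_pos_holds).ne'⟩
  obtain ⟨hr, h32, hmult, hirr⟩ := hX
  -- ONE odd Heegner datum with a Manin-good frame (Hoffstein–Luo field; Mazur; w_K = 2)
  obtain ⟨K, _, _, Dt, H, ι, P, Wd, _, _, Cd, hK, hodd, h3d, hHN, hP, hc, hμ, hLt, hWd⟩ :=
    exists_oddHeegnerData hnf hHL hMaz integral_neronScaling_of_isGloballyMinimal_holds W 3 hr h32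
      hmult hirr
  have h3 : NumberField.discr K ≠ -3 := by
    intro h
    exact h3d (h ▸ ⟨-1, by norm_num⟩)
  have h4 : NumberField.discr K ≠ -4 := by
    intro h
    rw [h] at hodd
    exact (Int.not_odd_iff_even.mpr ⟨-2, by norm_num⟩) hodd
  -- a conductor-1 Kolyvagin–Heegner datum on the frame (Dt, H.β, ι), with bottom point y_K = P
  obtain ⟨d₁⟩ := exists_kolyvaginHeegnerData_one (hD36 _ W K) hK Dt H.β ι H.dvd_sq_sub
  have hPd : d₁.toGeomPoints d₁.derivedPoint = toGeomPoints (W.baseChange K) P :=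
    KolyvaginBottom.toGeomPoints_derivedPoint_one_eq (hrec _ W K) hK hHN hP d₁ rfl
  -- the sharpened bound over K at this datum, from J₃⁰ + McCallum (§1)
  have hU : Finite (W.baseChange K).sha → ¬ IsOfFinAddOrder P →
      padicValNat 3 (Nat.card (W.baseChange K).sha) + 2 * padicValNat 3 W.tamagawaProduct ≤
        2 * padicValNat 3 (AddSubgroup.zmultiples P).index := by
    intro hfin hPinf
    haveI : Finite (W.baseChange K).sha := hfin
    obtain ⟨hrank, -⟩ := hKo (W.conductorNorm ℤ) W K hK hHN ⟨Dt, H, ι, hP⟩ hPinf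
    have hbot := torsionBy_eq_bot_of_isImaginaryQuadratic_of_hasIrreducibleModPGaloisRep W K hK
      Nat.prime_three hirr
    have hiv : ∀ x : (W.baseChange K).toAffine.Point, 3 • x = 0 → x = 0 := fun x hx ↦ by
      have hmem : x ∈ AddSubgroup.torsionBy (W.baseChange K).toAffine.Point ((3 : ℕ) : ℤ) := by
        rw [mem_torsionBy_iff, natCast_zsmul]
        exact hx
      rw [hbot] at hmem
      exact hmem
    exact shaIndexBound_sharp_three_of_globalDivisibility hMcU W K hmult hρ hK h3 h4 hHN Dt H.β ι d₁ P
      hPd hPinf hrank hiv (hJ0 W K Dt H.β ι hr hmult hρ hnram hK hHN hodd hLt H.dvd_sq_sub hc)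
  -- the twist: transports (no (ram) needed) and TL₃ at its minimal model
  have hD0 : (NumberField.discr K : ℚ) ≠ 0 := by exact_mod_cast NumberField.discr_ne_zero K
  haveI hEt : (W.quadraticTwist (NumberField.discr K : ℚ)).IsElliptic :=
    W.isElliptic_quadraticTwist hD0
  have hmultd : Wd.HasMultiplicativeReductionAtPrime 3 :=
    hasMultiplicativeReductionAtPrime_twist_of_heegner' W 3 K hK hHN hmult Cd hWd
  have hirrd : Wd.HasIrreducibleModPGaloisRep 3 :=
    hasIrreducibleModPGaloisRep_twist_model W 3 K hK.1 hirr Cd hWd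
  have htam : padicValNat 3 Wd.tamagawaProduct = padicValNat 3 W.tamagawaProduct :=
    X2.padicValNat_tamagawaProduct_twist_of_heegner_of_odd W 3 h32 K hK hodd h3d hHN Cd hWd
  have hu : padicValRat 3 (Cd.u : ℚ) = 0 :=
    padicValRat_u_eq_zero_of_twist_minimal W 3 K hK hHN hmult Cd hWd
  have hLt' : (W.quadraticTwist (NumberField.discr K : ℚ)).entireLFunction = Wd.entireLFunction := by
    rw [← hWd, entireLFunction_smul]
  have hLd1 : Wd.entireLFunction 1 ≠ 0 := by rw [← hLt']; exact hLt
  have hfinSd : Finite Wd.sha := (hGZK Wd (by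
    rw [(Wd.analyticRank_eq_zero_iff_holds (hmod Wd)).2 hLd1]; omega)).2
  obtain ⟨qd, hqd, hvqd⟩ := hTL Wd hmultd hirrd hLd1 hfinSd
  -- descent to ℚ (x11b3's data-level arithmetic)
  exact missingUpperBoundAt_of_shaIndexBound_sharp W 3 (W.conductorNorm ℤ) K Dt H ι P (hGZ _ W K)
    (hKo _ W K) hGZK hmod hK hHN hP h32 hc hμ hr hLt Wd Cd hWd hu htam le_rfl ⟨qd, hqd, hvqd⟩ hU

/-! ### §3 The crux BY NAME from {J₃ʳ♭, J₃⁰♭, TL₃} -/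

/-- **Item 19109 `EulerHalvesAtThree` BY NAME from the published named facts and exactly {J₃ʳ♭, J₃⁰♭, TL₃}** —
file 2's `classRecordThree_eulerHalvesAtThree_of_jetchevDivisibility_of_twistLower` with both Jetchev binders
NARROWED to Hoffstein–Luo-type frames (`r_an = 1`, `d_K` odd, `L(E^{d_K},1) ≠ 0`). With the companion file
`…JetchevNecessary.lean` the two narrowed binders are also NECESSARY for the crux's (ram) ∕ (0) content modulo print.
CONDITIONAL on every binder; the item does NOT close by this theorem. [cite: McCallumLMS1991, §5 Cor. 5.6 (p. 310)]
[cite: Jetchev2008, Conj. 1.3 (p. 812)] [cite: Skinner2016PacificMC, Thm. C (§1)] -/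
theorem classRecordThree_eulerHalvesAtThree_of_jetchevDivisibilityHL_of_twistLower
    (hGZ : ∀ (N : ℕ) [NeZero N] (W : WeierstrassCurve ℚ) (K : Type) [Field K] [NumberField K],
      gross_zagier N W K)
    (hKo : ∀ (N : ℕ) [NeZero N] (W : WeierstrassCurve ℚ) (K : Type) [Field K] [NumberField K],
      kolyvagin N W K)
    (hSk : Skinner2016.thmC_padicValRat_bsd_rank_zero)
    (hGZK : rank_eq_analyticRank_of_analyticRank_le_one) (hmod : hasEntireLFunction_rat)
    (hnf : exists_isNewformOf) (hHL : HoffsteinLuo1997_exists_twist_L_one_ne_zero)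
    (hMaz : mazur_not_dvd_maninConstant_of_odd)
    (hrec : ∀ (N : ℕ) [NeZero N] (W : WeierstrassCurve ℚ) (K : Type) [Field K] [NumberField K],
      heegnerPointOfConductor_one_galoisConj N W K)
    (hD36 : ∀ (N : ℕ) [NeZero N] (W : WeierstrassCurve ℚ) (K : Type) [Field K] [NumberField K],
      phi_heegnerTau_mem_singularModuliField N W K)
    (hMcU : McCallum1991_padicValNat_card_sha_primary_add_le_of_globalDivisibility)
    -- OPEN INPUT J₃ʳ
    (hJ : ∀ (W : WeierstrassCurve ℚ) [W.IsElliptic] [W.IsGloballyMinimal] [NeZero (W.conductorNorm ℤ)]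
      (K : Type) [Field K] [NumberField K]
      (Dt : ModularParametrizationData W (W.conductorNorm ℤ)) (β : ℤ) (ι : K →+* ℂ),
      W.analyticRank = 1 → W.HasMultiplicativeReductionAtPrime 3 → Surj W 3 → Ram W 3 →
      IsImaginaryQuadratic K → SatisfiesHeegnerHypothesis (W.conductorNorm ℤ) K →
      Odd (NumberField.discr K) → (W.quadraticTwist (NumberField.discr K : ℚ)).entireLFunction 1 ≠ 0 →
      (4 * (W.conductorNorm ℤ : ℤ)) ∣ β ^ 2 - NumberField.discr K → ¬ (3 : ℤ) ∣ Dt.c →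
      ∀ (s : ℕ), s ≤ padicValNat 3 W.tamagawaProduct →
        ∀ (n : ℕ) (d : KolyvaginHeegnerData Dt β ι n), Squarefree n →
          (∀ ℓ ∈ n.primeFactors, Zhang2014.IsKolyvaginPrime (W.conductorNorm ℤ) W K 3 ℓ ∧
            s ≤ Zhang2014.kolyvaginIndex W 3 ℓ) → PDiv d 3 s)
    -- OPEN INPUT J₃⁰
    (hJ0 : ∀ (W : WeierstrassCurve ℚ) [W.IsElliptic] [W.IsGloballyMinimal] [NeZero (W.conductorNorm ℤ)]
      (K : Type) [Field K] [NumberField K]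
      (Dt : ModularParametrizationData W (W.conductorNorm ℤ)) (β : ℤ) (ι : K →+* ℂ),
      W.analyticRank = 1 → W.HasMultiplicativeReductionAtPrime 3 → Surj W 3 → ¬ Ram W 3 →
      IsImaginaryQuadratic K → SatisfiesHeegnerHypothesis (W.conductorNorm ℤ) K →
      Odd (NumberField.discr K) → (W.quadraticTwist (NumberField.discr K : ℚ)).entireLFunction 1 ≠ 0 →
      (4 * (W.conductorNorm ℤ : ℤ)) ∣ β ^ 2 - NumberField.discr K → ¬ (3 : ℤ) ∣ Dt.c →
      ∀ (s : ℕ), s ≤ padicValNat 3 W.tamagawaProduct →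
        ∀ (n : ℕ) (d : KolyvaginHeegnerData Dt β ι n), Squarefree n →
          (∀ ℓ ∈ n.primeFactors, Zhang2014.IsKolyvaginPrime (W.conductorNorm ℤ) W K 3 ℓ ∧
            s ≤ Zhang2014.kolyvaginIndex W 3 ℓ) → PDiv d 3 s)
    -- OPEN INPUT TL₃
    (hTL : ∀ (V : WeierstrassCurve ℚ) [V.IsElliptic] [V.IsGloballyMinimal],
      V.HasMultiplicativeReductionAtPrime 3 → V.HasIrreducibleModPGaloisRep 3 →
      V.entireLFunction 1 ≠ 0 → Finite V.sha →
      ∃ q : ℚ, V.entireLFunction 1 / (V.realPeriodRat : ℂ) = (q : ℂ) ∧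
        padicValRat 3 q ≤ (padicValNat 3 V.shaOrder : ℤ) + padicValNat 3 V.tamagawaProduct -
          2 * padicValNat 3 V.torsionOrder) :
    Summit.BirchSwinnertonDyer.BirchSwinnertonDyer.Theses.ClassRecordThree.EulerHalvesAtThree := by
  unfold Summit.BirchSwinnertonDyer.BirchSwinnertonDyer.Theses.ClassRecordThree.EulerHalvesAtThree
  intro W _ _ hX
  refine ⟨fun hram _ ↦ ?_, fun hram _ _ _ ↦ ?_, fun hρ hnram ↦ ?_⟩
  · exact missingUpperBoundAt_three_of_classX11b_of_ram_of_jetchevDivisibilityHL hGZ hKo hSk hGZK hmod hnf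
      hHL hMaz hrec hD36 hMcU hJ W hX hram
  · exact missingUpperBoundAt_three_of_classX11b_of_ram_of_jetchevDivisibilityHL hGZ hKo hSk hGZK hmod hnf
      hHL hMaz hrec hD36 hMcU hJ W hX hram
  · exact missingUpperBoundAt_three_of_classX11b_of_surj_of_not_ram_of_jetchevDivisibilityHL_of_twistLower
      hGZ hKo hGZK hmod hnf hHL hMaz hrec hD36 hMcU hJ0 hTL W hX hρ hnram

/-- **The shared decl of route `KolyvaginRoadThree` (same statement) from the same narrowed inputs.** [folklore] -/
theorem kolyvaginRoadThree_eulerHalvesAtThree_of_jetchevDivisibilityHL_of_twistLower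
    (hGZ : ∀ (N : ℕ) [NeZero N] (W : WeierstrassCurve ℚ) (K : Type) [Field K] [NumberField K],
      gross_zagier N W K)
    (hKo : ∀ (N : ℕ) [NeZero N] (W : WeierstrassCurve ℚ) (K : Type) [Field K] [NumberField K],
      kolyvagin N W K)
    (hSk : Skinner2016.thmC_padicValRat_bsd_rank_zero)
    (hGZK : rank_eq_analyticRank_of_analyticRank_le_one) (hmod : hasEntireLFunction_rat)
    (hnf : exists_isNewformOf) (hHL : HoffsteinLuo1997_exists_twist_L_one_ne_zero)
    (hMaz : mazur_not_dvd_maninConstant_of_odd)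
    (hrec : ∀ (N : ℕ) [NeZero N] (W : WeierstrassCurve ℚ) (K : Type) [Field K] [NumberField K],
      heegnerPointOfConductor_one_galoisConj N W K)
    (hD36 : ∀ (N : ℕ) [NeZero N] (W : WeierstrassCurve ℚ) (K : Type) [Field K] [NumberField K],
      phi_heegnerTau_mem_singularModuliField N W K)
    (hMcU : McCallum1991_padicValNat_card_sha_primary_add_le_of_globalDivisibility)
    (hJ : ∀ (W : WeierstrassCurve ℚ) [W.IsElliptic] [W.IsGloballyMinimal] [NeZero (W.conductorNorm ℤ)]
      (K : Type) [Field K] [NumberField K]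
      (Dt : ModularParametrizationData W (W.conductorNorm ℤ)) (β : ℤ) (ι : K →+* ℂ),
      W.analyticRank = 1 → W.HasMultiplicativeReductionAtPrime 3 → Surj W 3 → Ram W 3 →
      IsImaginaryQuadratic K → SatisfiesHeegnerHypothesis (W.conductorNorm ℤ) K →
      Odd (NumberField.discr K) → (W.quadraticTwist (NumberField.discr K : ℚ)).entireLFunction 1 ≠ 0 →
      (4 * (W.conductorNorm ℤ : ℤ)) ∣ β ^ 2 - NumberField.discr K → ¬ (3 : ℤ) ∣ Dt.c →
      ∀ (s : ℕ), s ≤ padicValNat 3 W.tamagawaProduct →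
        ∀ (n : ℕ) (d : KolyvaginHeegnerData Dt β ι n), Squarefree n →
          (∀ ℓ ∈ n.primeFactors, Zhang2014.IsKolyvaginPrime (W.conductorNorm ℤ) W K 3 ℓ ∧
            s ≤ Zhang2014.kolyvaginIndex W 3 ℓ) → PDiv d 3 s)
    (hJ0 : ∀ (W : WeierstrassCurve ℚ) [W.IsElliptic] [W.IsGloballyMinimal] [NeZero (W.conductorNorm ℤ)]
      (K : Type) [Field K] [NumberField K]
      (Dt : ModularParametrizationData W (W.conductorNorm ℤ)) (β : ℤ) (ι : K →+* ℂ),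
      W.analyticRank = 1 → W.HasMultiplicativeReductionAtPrime 3 → Surj W 3 → ¬ Ram W 3 →
      IsImaginaryQuadratic K → SatisfiesHeegnerHypothesis (W.conductorNorm ℤ) K →
      Odd (NumberField.discr K) → (W.quadraticTwist (NumberField.discr K : ℚ)).entireLFunction 1 ≠ 0 →
      (4 * (W.conductorNorm ℤ : ℤ)) ∣ β ^ 2 - NumberField.discr K → ¬ (3 : ℤ) ∣ Dt.c →
      ∀ (s : ℕ), s ≤ padicValNat 3 W.tamagawaProduct →
        ∀ (n : ℕ) (d : KolyvaginHeegnerData Dt β ι n), Squarefree n →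
          (∀ ℓ ∈ n.primeFactors, Zhang2014.IsKolyvaginPrime (W.conductorNorm ℤ) W K 3 ℓ ∧
            s ≤ Zhang2014.kolyvaginIndex W 3 ℓ) → PDiv d 3 s)
    (hTL : ∀ (V : WeierstrassCurve ℚ) [V.IsElliptic] [V.IsGloballyMinimal],
      V.HasMultiplicativeReductionAtPrime 3 → V.HasIrreducibleModPGaloisRep 3 →
      V.entireLFunction 1 ≠ 0 → Finite V.sha →
      ∃ q : ℚ, V.entireLFunction 1 / (V.realPeriodRat : ℂ) = (q : ℂ) ∧
        padicValRat 3 q ≤ (padicValNat 3 V.shaOrder : ℤ) + padicValNat 3 V.tamagawaProduct -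
          2 * padicValNat 3 V.torsionOrder) :
    Summit.BirchSwinnertonDyer.BirchSwinnertonDyer.Theses.KolyvaginRoadThree.EulerHalvesAtThree :=
  classRecordThree_eulerHalvesAtThree_of_jetchevDivisibilityHL_of_twistLower hGZ hKo hSk hGZK hmod hnf hHL
    hMaz hrec hD36 hMcU hJ hJ0 hTL

/-! ### §4 The registered broad stubs imply the narrowed ones -/

/-- **J₃ʳ ⟹ J₃ʳ♭** (the broad registered stub implies the narrowed binder): at a Heegner `K` of a curve
multiplicative at `3`, `3` splits in `K`, so `3 ∤ d_K` and `d_K ≠ −3`; the extra hypotheses of J₃ʳ♭ are simply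
dropped. [folklore] -/
theorem jetchevDivisibilityRamHL_of_jetchevDivisibilityRam
    (hJ : ∀ (W : WeierstrassCurve ℚ) [W.IsElliptic] [W.IsGloballyMinimal] [NeZero (W.conductorNorm ℤ)]
      (K : Type) [Field K] [NumberField K]
      (Dt : ModularParametrizationData W (W.conductorNorm ℤ)) (β : ℤ) (ι : K →+* ℂ),
      W.HasMultiplicativeReductionAtPrime 3 → Surj W 3 → Ram W 3 →
      IsImaginaryQuadratic K → SatisfiesHeegnerHypothesis (W.conductorNorm ℤ) K →
      NumberField.discr K ≠ -3 →
      (4 * (W.conductorNorm ℤ : ℤ)) ∣ β ^ 2 - NumberField.discr K → ¬ (3 : ℤ) ∣ Dt.c →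
      ∀ (s : ℕ), s ≤ padicValNat 3 W.tamagawaProduct →
        ∀ (n : ℕ) (d : KolyvaginHeegnerData Dt β ι n), Squarefree n →
          (∀ ℓ ∈ n.primeFactors, Zhang2014.IsKolyvaginPrime (W.conductorNorm ℤ) W K 3 ℓ ∧
            s ≤ Zhang2014.kolyvaginIndex W 3 ℓ) → PDiv d 3 s) :
    ∀ (W : WeierstrassCurve ℚ) [W.IsElliptic] [W.IsGloballyMinimal] [NeZero (W.conductorNorm ℤ)]
      (K : Type) [Field K] [NumberField K]
      (Dt : ModularParametrizationData W (W.conductorNorm ℤ)) (β : ℤ) (ι : K →+* ℂ),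
      W.analyticRank = 1 → W.HasMultiplicativeReductionAtPrime 3 → Surj W 3 → Ram W 3 →
      IsImaginaryQuadratic K → SatisfiesHeegnerHypothesis (W.conductorNorm ℤ) K →
      Odd (NumberField.discr K) → (W.quadraticTwist (NumberField.discr K : ℚ)).entireLFunction 1 ≠ 0 →
      (4 * (W.conductorNorm ℤ : ℤ)) ∣ β ^ 2 - NumberField.discr K → ¬ (3 : ℤ) ∣ Dt.c →
      ∀ (s : ℕ), s ≤ padicValNat 3 W.tamagawaProduct →
        ∀ (n : ℕ) (d : KolyvaginHeegnerData Dt β ι n), Squarefree n →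
          (∀ ℓ ∈ n.primeFactors, Zhang2014.IsKolyvaginPrime (W.conductorNorm ℤ) W K 3 ℓ ∧
            s ≤ Zhang2014.kolyvaginIndex W 3 ℓ) → PDiv d 3 s := by
  intro W _ _ _ K _ _ Dt β ι _hr hmult hρ hram hK hHN _hodd _hLt hβ hc
  haveI : Fact (Nat.Prime 3) := ⟨Nat.prime_three⟩
  have h3split : SatisfiesHeegnerHypothesis 3 K :=
    SatisfiesHeegnerHypothesis.of_dvd (dvd_conductorNorm_of_mult (W := W) hmult) hHN
  have hpd : ¬ ((3 : ℕ) : ℤ) ∣ NumberField.discr K :=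
    not_dvd_discr_of_split hK Nat.prime_three (by norm_num) h3split
  have h3 : NumberField.discr K ≠ -3 := fun h ↦ hpd (h ▸ ⟨-1, by norm_num⟩)
  exact hJ W K Dt β ι hmult hρ hram hK hHN h3 hβ hc

/-- **J₃⁰ ⟹ J₃⁰♭** (same bookkeeping on ¬(ram) frames). [folklore] -/
theorem jetchevDivisibilityNotRamHL_of_jetchevDivisibilityNotRam
    (hJ0 : ∀ (W : WeierstrassCurve ℚ) [W.IsElliptic] [W.IsGloballyMinimal] [NeZero (W.conductorNorm ℤ)]
      (K : Type) [Field K] [NumberField K]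
      (Dt : ModularParametrizationData W (W.conductorNorm ℤ)) (β : ℤ) (ι : K →+* ℂ),
      W.HasMultiplicativeReductionAtPrime 3 → Surj W 3 → ¬ Ram W 3 →
      IsImaginaryQuadratic K → SatisfiesHeegnerHypothesis (W.conductorNorm ℤ) K →
      NumberField.discr K ≠ -3 →
      (4 * (W.conductorNorm ℤ : ℤ)) ∣ β ^ 2 - NumberField.discr K → ¬ (3 : ℤ) ∣ Dt.c →
      ∀ (s : ℕ), s ≤ padicValNat 3 W.tamagawaProduct →
        ∀ (n : ℕ) (d : KolyvaginHeegnerData Dt β ι n), Squarefree n →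
          (∀ ℓ ∈ n.primeFactors, Zhang2014.IsKolyvaginPrime (W.conductorNorm ℤ) W K 3 ℓ ∧
            s ≤ Zhang2014.kolyvaginIndex W 3 ℓ) → PDiv d 3 s) :
    ∀ (W : WeierstrassCurve ℚ) [W.IsElliptic] [W.IsGloballyMinimal] [NeZero (W.conductorNorm ℤ)]
      (K : Type) [Field K] [NumberField K]
      (Dt : ModularParametrizationData W (W.conductorNorm ℤ)) (β : ℤ) (ι : K →+* ℂ),
      W.analyticRank = 1 → W.HasMultiplicativeReductionAtPrime 3 → Surj W 3 → ¬ Ram W 3 →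
      IsImaginaryQuadratic K → SatisfiesHeegnerHypothesis (W.conductorNorm ℤ) K →
      Odd (NumberField.discr K) → (W.quadraticTwist (NumberField.discr K : ℚ)).entireLFunction 1 ≠ 0 →
      (4 * (W.conductorNorm ℤ : ℤ)) ∣ β ^ 2 - NumberField.discr K → ¬ (3 : ℤ) ∣ Dt.c →
      ∀ (s : ℕ), s ≤ padicValNat 3 W.tamagawaProduct →
        ∀ (n : ℕ) (d : KolyvaginHeegnerData Dt β ι n), Squarefree n →
          (∀ ℓ ∈ n.primeFactors, Zhang2014.IsKolyvaginPrime (W.conductorNorm ℤ) W K 3 ℓ ∧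
            s ≤ Zhang2014.kolyvaginIndex W 3 ℓ) → PDiv d 3 s := by
  intro W _ _ _ K _ _ Dt β ι _hr hmult hρ hnram hK hHN _hodd _hLt hβ hc
  haveI : Fact (Nat.Prime 3) := ⟨Nat.prime_three⟩
  have h3split : SatisfiesHeegnerHypothesis 3 K :=
    SatisfiesHeegnerHypothesis.of_dvd (dvd_conductorNorm_of_mult (W := W) hmult) hHN
  have hpd : ¬ ((3 : ℕ) : ℤ) ∣ NumberField.discr K :=
    not_dvd_discr_of_split hK Nat.prime_three (by norm_num) h3split
  have h3 : NumberField.discr K ≠ -3 := fun h ↦ hpd (h ▸ ⟨-1, by norm_num⟩)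
  exact hJ0 W K Dt β ι hmult hρ hnram hK hHN h3 hβ hc

end Summit.BirchSwinnertonDyer.Rank1Residual.X11b.Three.Koly

end
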